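import Summits.HodgeConjecture.HodgeConjecture.Theorems.VHCAbelianSchemesRoadRegimeAdditive
import HarnessLib

/-!
# Road b02 (`VHCAbelianSchemesRoad`, D-0059) — the `closes`-shape KERNEL for the ADDITIVE (SPAN) form of regime 2:
# node (U), row b02 and `HC_AV` from the door and the DIAGONAL `(2m, m)` of the additive graded crux

research route conditional on HC_CM; not a corollary; Q11.4-sentence-2 already refuted in dim ≥ 3.
(cell line of seat ab-andre-2: research route, not a corollary; conditional on HC_CM plus one named minimal statement.)

THEOREMS ONLY (no definition, no named fact, no sorry; `HC_CM` occurs nowhere). Companion of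
`VHCAbelianSchemesRoadRegimeAdditive.lean` (the predicates `LefAtExceptionalRegimeAtAdd` / `AdmissibleRepresentativesLefAtDegAdd`, single ⟹
additive, the per-pencil lemma `not_countable_algebraicityLocus_of_lefAtDegAdd`, regime 2 (additive) ⟹ the additive graded crux).
Seat ab-andre-2 gen 66 (K-ADD of director-hodge R11.3, 2026-08-27; evidence #49 / #51 on item stmt-HodgeConjecture-20707); helper
`--supports stmt-HodgeConjecture-20707`; the route file, its `closes` glue of record, the binders of record and the skeleton are NOT touched.

* §4 engine twins of `VHCAbelianSchemesRoadDiagonal.lean` §3–§4 VERBATIM with `AdmissibleRepresentativesLefAtDeg ↦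
  AdmissibleRepresentativesLefAtDegAdd` (lower shadow, middle lift of the padded pencil, `HCUpToDim G`): node (U), row b02 and `HC_AV`
  from the door and the DIAGONAL `(2m, m)` of the additive graded crux; `hc_av_of_exceptionalRegimeAtAdd_diagonal_two` door-generic.
* §5 the kernel heads over the twisted door: `hc_av_of_exceptionalRegimeAtAdd_twisted_diagonal_two` (EVERY admissibility notion
  `Adm`, door `TwistedPerfectDoorVHC C Adm` VERBATIM, NO inclusion hypothesis — regime 1 is datum-free in additive form), its instance
  `hc_av_of_exceptionalRegimeAtAdd_admTw'_diagonal_two` at the road's PRIMED door `AdmTw'` with EXACTLY the binder shape of the glue of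
  record `hc_av_of_exceptionalRegimeAt_admTw'_diagonal_two` (`hC hDiag hDoor hR h₂₁ h₂₂`) but `hDiag` the ADDITIVE diagonal slice; the
  `(6, 3)`-on twins granted `HCUpToDim 5`; «slice of record ⟹ additive slice» (so the rev-22 binders also feed the additive kernel —
  not restated as a theorem: its statement would coincide with the glue of record `hc_av_of_exceptionalRegimeAt_admTw'_diagonal_two`).

NOT claimed: any cell of either regime; anything about `HC_CM`. References: [BrosnanFangNiePearlstein2009] §6 Lemma 48;
[Lieberman1968]; [KerrPearlstein2011] §3.1; [CharlesSchnell2014Notes] Conj. 11.3.1, Prop. 11.3.11, Cor. 11.3.6; [BuchweitzFlenner2003]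
§5 Thm. 5.1; [Markman2025SurveySecant] Cor. 1.3; [Markman2025SecantWeil] Thm. 1.4.1, Thm. 1.5.1; [Andre1996Motifs] §6.3;
[GortzWedhorn2023] Thm. 27.291; [Pridham2024Semiregularity] Cor. 2.25, Rem. 2.26; [VoisinHodgeII2003] §10.2.3.
-/

noncomputable section

open CategoryTheory CategoryTheory.Limits AlgebraicGeometry Topology MonoidalCategory CartesianMonoidalCategory

namespace Summit.HodgeConjecture.HodgeConjecture.Ring2.SemiregularRepresentatives

set_option linter.dupNamespace false -- the cell's namespace repeats the summit name, as in every `Ring2*` file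

open Literature.AlgebraicGeometry Literature.AlgebraicGeometry.Motives Literature.AlgebraicGeometry.HodgeTheory
open Literature.AlgebraicTopology.SingularHomology
open Literature.AlgebraicGeometry.Andre1996 (andre1996_cmAnchoredPencil
  andre1996_cmHodgeClasses_algebraicallyAnchoredPencils)
open Summit.Ventures.HSemireg (ObjClass LocalVariationalHodgeFor)
open Summit.HodgeConjecture.HodgeConjecture.Ring2.Hypotheses (AbelianSchemeVHC)
open Summit.HodgeConjecture.HodgeConjecture.Ring2.Binders
open Summit.HodgeConjecture.HodgeConjecture.Ring2.ClassTargets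

variable {𝒪 : ObjClass} {𝒳 S : SchemeOver ℂ}

/-! ## §4 Engine twins: node (U), row b02 and `HC_AV` from the door and the DIAGONAL of the additive graded crux -/

/-- **The conclusion of node (U) at `(n, p)` from the DIAGONAL cells above `G` of the ADDITIVE graded crux, per pencil**
(`G < n`, `2p ≤ n`): twin of `not_countable_algebraicityLocus_of_diagonal_of_lowerHalf` (pad by an abelian variety of dimension
`n − 2p`, middle lift, same algebraicity locus). [cite: BrosnanFangNiePearlstein2009, §6 Lemma 48] [cite: Lieberman1968, main theorem]
[cite: BuchweitzFlenner2003, §5 Thm. 5.1] -/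
theorem not_countable_algebraicityLocus_of_diagonalAdd_of_lowerHalf (hT : LocalVariationalHodgeFor 𝒪)
    {G : ℕ} (hSR : ∀ m : ℕ, G < 2 * m → AdmissibleRepresentativesLefAtDegAdd 𝒪 (2 * m) m)
    (f : 𝒳 ⟶ S) {n : ℕ} (hf : IsSmoothProjectiveFamily f n) (hGn : G < n) (h𝒳 : IsQuasiProjectiveOver 𝒳)
    [IrreducibleSpace S.left] [IsAffine S.left] [AlgebraicGeometry.Smooth S.hom] (hdim : topologicalKrullDim S.left = 1)
    (habel : ∀ s : ComplexPoints S, ∃ A' : AbelianVariety ℂ, A'.dim = n ∧ Nonempty (A'.X ≅ fiberOver f s))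
    (he : ∃ e : S ⟶ 𝒳, e ≫ f = 𝟙 S) {p : ℕ} (hpn : 2 * p ≤ n) (W : complexBetti 𝒳 (2 * p))
    (hW : ∀ s : ComplexPoints S, IsRationalClass (complexBetti.map (fiberι f s) (2 * p) W) ∧
      IsOfHodgeType n (fiberOver f s) (2 * p) p p (complexBetti.map (fiberι f s) (2 * p) W))
    {s₀ : ComplexPoints S} (hs₀ : complexBetti.map (fiberι f s₀) (2 * p) W ∈ algebraicClasses (fiberOver f s₀) p) :
    ¬ {s : ComplexPoints S |
        complexBetti.map (fiberι f s) (2 * p) W ∈ algebraicClasses (fiberOver f s) p}.Countable := by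
  haveI : LocallyOfFiniteType S.hom := inferInstance
  haveI : IsSeparated S.hom := (IsQuasiProjectiveOver.of_isAffine S).isSeparated
  rcases Nat.eq_or_lt_of_le hpn with hmid | hlt
  · -- already in the middle: the diagonal cell `(2p, p)` of the pencil itself
    subst hmid
    exact not_countable_algebraicityLocus_of_lefAtDegAdd hT (hSR p hGn) f hf h𝒳 hdim habel he W hW hs₀
  · -- pad by `B`, `dim B = n - 2p ≥ 1`, and lift `W` to the middle of `𝒳 × B ⟶ S`
    obtain ⟨B, hB⟩ := exists_abelianVariety_dim_eq_succ ℂ (n - 2 * p - 1)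
    have hpB : 2 * p + B.dim = n := by omega
    obtain ⟨hf', habel', W', hW', hiff⟩ := exists_middleLift f hf h𝒳 habel B hpB W hW
    have hmid : n + B.dim = 2 * (p + B.dim) := by omega
    rw [hmid] at hf' habel' hW'
    have h := not_countable_algebraicityLocus_of_lefAtDegAdd hT (hSR (p + B.dim) (by omega)) (fst 𝒳 B.X ≫ f) hf'
      (isQuasiProjectiveOver_tensor h𝒳 (AbelianVariety.isSmoothProjective_holds (A := B)).isProjectiveOver) hdim habel'
      (exists_section_fst_comp f he B) W' hW' ((hiff s₀).2 hs₀)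
    have hset : {s : ComplexPoints S | complexBetti.map (fiberι (fst 𝒳 B.X ≫ f) s) (2 * (p + B.dim)) W' ∈
          algebraicClasses (fiberOver (fst 𝒳 B.X ≫ f) s) (p + B.dim)} =
        {s : ComplexPoints S | complexBetti.map (fiberι f s) (2 * p) W ∈ algebraicClasses (fiberOver f s) p} :=
      Set.ext fun s => hiff s
    rwa [hset] at h

/-- **The conclusion of node (U) at `(n, p)` from the DIAGONAL cells above `G` of the ADDITIVE graded crux, per pencil, EVERY
`p`** (`G < n`): twin of `not_countable_algebraicityLocus_of_diagonal` (no non-zero `(p,p)`-classes for `p > n`; the lower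
shadow above the middle; then padding). [cite: KerrPearlstein2011, §3.1] [cite: Lieberman1968, main theorem]
[cite: BrosnanFangNiePearlstein2009, §6 Lemma 48] -/
theorem not_countable_algebraicityLocus_of_diagonalAdd (hT : LocalVariationalHodgeFor 𝒪)
    {G : ℕ} (hSR : ∀ m : ℕ, G < 2 * m → AdmissibleRepresentativesLefAtDegAdd 𝒪 (2 * m) m)
    (f : 𝒳 ⟶ S) {n : ℕ} (hf : IsSmoothProjectiveFamily f n) (hGn : G < n) (h𝒳 : IsQuasiProjectiveOver 𝒳)
    [IrreducibleSpace S.left] [IsAffine S.left] [AlgebraicGeometry.Smooth S.hom] (hdim : topologicalKrullDim S.left = 1)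
    (habel : ∀ s : ComplexPoints S, ∃ A' : AbelianVariety ℂ, A'.dim = n ∧ Nonempty (A'.X ≅ fiberOver f s))
    (he : ∃ e : S ⟶ 𝒳, e ≫ f = 𝟙 S) (p : ℕ) (W : complexBetti 𝒳 (2 * p))
    (hW : ∀ s : ComplexPoints S, IsRationalClass (complexBetti.map (fiberι f s) (2 * p) W) ∧
      IsOfHodgeType n (fiberOver f s) (2 * p) p p (complexBetti.map (fiberι f s) (2 * p) W))
    {s₀ : ComplexPoints S} (hs₀ : complexBetti.map (fiberι f s₀) (2 * p) W ∈ algebraicClasses (fiberOver f s₀) p) :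
    ¬ {s : ComplexPoints S |
        complexBetti.map (fiberι f s) (2 * p) W ∈ algebraicClasses (fiberOver f s) p}.Countable := by
  haveI : LocallyOfFiniteType S.hom := inferInstance
  by_cases hpn : 2 * p ≤ n
  · exact not_countable_algebraicityLocus_of_diagonalAdd_of_lowerHalf hT hSR f hf hGn h𝒳 hdim habel he hpn W hW hs₀
  by_cases hnp : n < p
  · -- no non-zero `(p,p)`-classes: every fibre is algebraic
    have huniv : {s : ComplexPoints S |
        complexBetti.map (fiberι f s) (2 * p) W ∈ algebraicClasses (fiberOver f s) p} = Set.univ :=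
      Set.eq_univ_of_forall fun s => by
        rw [Set.mem_setOf_eq, (hW s).2.eq_zero_pp_of_lt hnp]
        exact Submodule.zero_mem _
    rw [huniv]
    exact not_countable_of_isOpen_of_curve hdim isOpen_univ ⟨s₀, Set.mem_univ _⟩
  · -- above the middle: the lower shadow of codimension `n - p`
    obtain ⟨q, j, hqj, hp⟩ : ∃ q j : ℕ, 2 * q + j = n ∧ q + j = p := ⟨n - p, 2 * p - n, by omega, by omega⟩
    subst hp
    obtain ⟨W', hW', hiff⟩ := exists_lowerShadow f hf h𝒳 (IsQuasiProjectiveOver.of_isAffine S) ‹_› habel hqj W hW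
    have h := not_countable_algebraicityLocus_of_diagonalAdd_of_lowerHalf hT hSR f hf hGn h𝒳 hdim habel he (by omega) W'
      hW' ((hiff s₀).2 hs₀)
    have hset : {s : ComplexPoints S | complexBetti.map (fiberι f s) (2 * q) W' ∈ algebraicClasses (fiberOver f s) q} =
        {s : ComplexPoints S | complexBetti.map (fiberι f s) (2 * (q + j)) W ∈
          algebraicClasses (fiberOver f s) (q + j)} :=
      Set.ext fun s => hiff s
    rwa [hset] at h

/-- **Node (U) from the door, the class target `HCUpToDim G` and the diagonal cells `(2m, m)`, `2m > G`, of the ADDITIVE graded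
crux.** Twin of `oneParameterAbelianSchemeVHCUncountable_of_hcUpToDim_of_lefAtDeg_diagonal`.
[cite: CharlesSchnell2014Notes, Conj. 11.3.1 and Prop. 11.3.11 (proof)] [cite: BrosnanFangNiePearlstein2009, §6 Lemma 48]
[cite: Lieberman1968, main theorem] [cite: BuchweitzFlenner2003, §5 Thm. 5.1] -/
theorem oneParameterAbelianSchemeVHCUncountable_of_hcUpToDim_of_lefAtDegAdd_diagonal
    (hT : LocalVariationalHodgeFor 𝒪) {G : ℕ} (hG : HCUpToDim G)
    (hSR : ∀ m : ℕ, G < 2 * m → AdmissibleRepresentativesLefAtDegAdd 𝒪 (2 * m) m) :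
    OneParameterAbelianSchemeVHCUncountable := by
  intro n 𝒳 S f hf h𝒳 hirr haff hsm hdim habel he p W hW s₀ hs₀
  haveI := hirr
  haveI := haff
  haveI := hsm
  rcases Nat.lt_or_ge G n with hGn | hnG
  · exact not_countable_algebraicityLocus_of_diagonalAdd hT hSR f hf hGn h𝒳 hdim habel he p W hW hs₀
  · exact not_countable_algebraicityLocus_of_hcUpToDim hG f hnG hdim habel p W hW s₀

/-- **Node (U) from the door and the diagonal cells `(2m, m)`, `m ≥ 2`, of the ADDITIVE graded crux — FACT-FREE** (relative
dimension `≤ 3` is unconditional, `Ring2.ClassTargets.hcUpToDim_three`). First cell used: `(4, 2)`.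
[cite: VoisinHodgeII2003, §10.2.3 proof of Prop. 10.26] [cite: BrosnanFangNiePearlstein2009, §6 Lemma 48] -/
theorem oneParameterAbelianSchemeVHCUncountable_of_lefAtDegAdd_diagonal_two (hT : LocalVariationalHodgeFor 𝒪)
    (hSR : ∀ m : ℕ, 2 ≤ m → AdmissibleRepresentativesLefAtDegAdd 𝒪 (2 * m) m) :
    OneParameterAbelianSchemeVHCUncountable :=
  oneParameterAbelianSchemeVHCUncountable_of_hcUpToDim_of_lefAtDegAdd_diagonal hT hcUpToDim_three
    fun m hm => hSR m (by omega)

/-- **Node (U) from the door, `HCUpToDim 5`** (Markman 2025 Cor. 1.3, UNREFEREED — the support item `HodgeAbelianDimLeFive`) **and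
the diagonal cells `(2m, m)`, `m ≥ 3`, of the ADDITIVE graded crux.** First cell used: `(6, 3)`.
[cite: Markman2025SurveySecant, Cor. 1.3] [cite: BrosnanFangNiePearlstein2009, §6 Lemma 48] -/
theorem oneParameterAbelianSchemeVHCUncountable_of_hcUpToDim_five_of_lefAtDegAdd_diagonal_three
    (hT : LocalVariationalHodgeFor 𝒪) (h₅ : HCUpToDim 5)
    (hSR : ∀ m : ℕ, 3 ≤ m → AdmissibleRepresentativesLefAtDegAdd 𝒪 (2 * m) m) :
    OneParameterAbelianSchemeVHCUncountable :=
  oneParameterAbelianSchemeVHCUncountable_of_hcUpToDim_of_lefAtDegAdd_diagonal hT h₅ fun m hm => hSR m (by omega)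

/-- **Row b02 from the door, the ADDITIVE diagonal `m ≥ 2` and the curve residual — no class target.**
[cite: CharlesSchnell2014Notes, Prop. 11.3.11 (proof)] [cite: GortzWedhorn2023, Thm. 27.291] -/
theorem abelianSchemeVHC_of_lefAtDegAdd_diagonal_two (hT : LocalVariationalHodgeFor 𝒪)
    (hSR : ∀ m : ℕ, 2 ≤ m → AdmissibleRepresentativesLefAtDegAdd 𝒪 (2 * m) m)
    (hqp : OneParameterAbelianSchemeQuasiProjective) : AbelianSchemeVHC :=
  abelianSchemeVHC_of_uncountable_of_oneParameterAbelianSchemeQuasiProjective hqp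
    (oneParameterAbelianSchemeVHCUncountable_of_lefAtDegAdd_diagonal_two hT hSR)

/-- **Row b02 from the door, `HCUpToDim 5`, the ADDITIVE diagonal `m ≥ 3` and the curve residual.**
[cite: CharlesSchnell2014Notes, Prop. 11.3.11 (proof)] [cite: Markman2025SurveySecant, Cor. 1.3] [cite: GortzWedhorn2023, Thm. 27.291] -/
theorem abelianSchemeVHC_of_hcUpToDim_five_of_lefAtDegAdd_diagonal_three (hT : LocalVariationalHodgeFor 𝒪)
    (h₅ : HCUpToDim 5) (hSR : ∀ m : ℕ, 3 ≤ m → AdmissibleRepresentativesLefAtDegAdd 𝒪 (2 * m) m)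
    (hqp : OneParameterAbelianSchemeQuasiProjective) : AbelianSchemeVHC :=
  abelianSchemeVHC_of_uncountable_of_oneParameterAbelianSchemeQuasiProjective hqp
    (oneParameterAbelianSchemeVHCUncountable_of_hcUpToDim_five_of_lefAtDegAdd_diagonal_three hT h₅ hSR)

/-- **`HC_AV` from the door, the ADDITIVE DIAGONAL `(2m, m)`, `m ≥ 2`, of the graded crux, the curve residual and André 1996
#21/#22 — no class target, no `HC_CM`.** Twin of `hc_av_of_lefAtDeg_diagonal_two`.
[cite: Andre1996Motifs, §6.3 Lemmes 6.3.1–6.3.3 and Remarque 2 (p. 33)] [cite: BrosnanFangNiePearlstein2009, §6 Lemma 48] -/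
theorem hc_av_of_lefAtDegAdd_diagonal_two (hT : LocalVariationalHodgeFor 𝒪)
    (hSR : ∀ m : ℕ, 2 ≤ m → AdmissibleRepresentativesLefAtDegAdd 𝒪 (2 * m) m)
    (hqp : OneParameterAbelianSchemeQuasiProjective) (h₂₁ : andre1996_cmAnchoredPencil)
    (h₂₂ : andre1996_cmHodgeClasses_algebraicallyAnchoredPencils) :
    Theses.PadicSemiregularLift.HodgeAbelianVarieties :=
  (Ring2.Deform.HC_AV_iff_abelianSchemeVHC_of_andre1996 h₂₁ h₂₂).mpr
    (abelianSchemeVHC_of_lefAtDegAdd_diagonal_two hT hSR hqp)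

/-- **`HC_AV` from the door, `HCUpToDim 5`, the ADDITIVE DIAGONAL `(2m, m)`, `m ≥ 3`, the curve residual and André 1996 #21/#22.**
[cite: Andre1996Motifs, §6.3 Lemmes 6.3.1–6.3.3 and Remarque 2 (p. 33)] [cite: Markman2025SurveySecant, Cor. 1.3]
[cite: BrosnanFangNiePearlstein2009, §6 Lemma 48] -/
theorem hc_av_of_hcUpToDim_five_of_lefAtDegAdd_diagonal_three (hT : LocalVariationalHodgeFor 𝒪)
    (h₅ : HCUpToDim 5) (hSR : ∀ m : ℕ, 3 ≤ m → AdmissibleRepresentativesLefAtDegAdd 𝒪 (2 * m) m)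
    (hqp : OneParameterAbelianSchemeQuasiProjective) (h₂₁ : andre1996_cmAnchoredPencil)
    (h₂₂ : andre1996_cmHodgeClasses_algebraicallyAnchoredPencils) :
    Theses.PadicSemiregularLift.HodgeAbelianVarieties :=
  (Ring2.Deform.HC_AV_iff_abelianSchemeVHC_of_andre1996 h₂₁ h₂₂).mpr
    (abelianSchemeVHC_of_hcUpToDim_five_of_lefAtDegAdd_diagonal_three hT h₅ hSR hqp)

/-- **`HC_AV` from the door and the ADDITIVE REGIME 2 on the diagonal `m ≥ 2` — door-generic** (regime 1 is datum-free, §3).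
[cite: Andre1996Motifs, §6.3 Lemmes 6.3.1–6.3.3] [cite: vanGeemen1994HodgeAV, §2.4] [cite: GortzWedhorn2023, Thm. 27.291] -/
theorem hc_av_of_exceptionalRegimeAtAdd_diagonal_two (hT : LocalVariationalHodgeFor 𝒪)
    (hDiag : ∀ m : ℕ, 2 ≤ m → LefAtExceptionalRegimeAtAdd 𝒪 (2 * m) m)
    (hqp : OneParameterAbelianSchemeQuasiProjective) (h₂₁ : andre1996_cmAnchoredPencil)
    (h₂₂ : andre1996_cmHodgeClasses_algebraicallyAnchoredPencils) :
    Theses.PadicSemiregularLift.HodgeAbelianVarieties :=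
  hc_av_of_lefAtDegAdd_diagonal_two hT (fun m hm => admissibleRepresentativesLefAtDegAdd_of_regimeAdd (hDiag m hm))
    hqp h₂₁ h₂₂

/-! ## §5 The kernel heads over the TWISTED door (every admissibility notion; the road's `AdmTw'`) -/

/-- **`HC_AV` in the `closes`-shape of road b02 with the crux replaced by the ADDITIVE diagonal slice
`∀ C m, 2 ≤ m → LefAtExceptionalRegimeAtAdd (twisted door at Adm) (2m) m`, for EVERY admissibility notion `Adm`** — K-C, the door
`TwistedPerfectDoorVHC C Adm` VERBATIM (the binder of record, read per `C`), Raynaud, André #21/#22; no inclusion hypothesis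
`bfSingleAdmissible(') ≤ Adm` (regime 1 is datum-free in additive form), no class target, no `HC_CM`. The binders are those of
`hc_av_of_exceptionalRegimeAt_twisted_diagonal_two_prime` MINUS `hAdm'`, with `hDiag` additive.
[cite: Andre1996Motifs, §6.3 Lemmes 6.3.1–6.3.3] [cite: BrosnanFangNiePearlstein2009, §6 Lemma 48]
[cite: Pridham2024Semiregularity, Rem. 2.26 with Cor. 2.25] [cite: GortzWedhorn2023, Thm. 27.291] -/
theorem hc_av_of_exceptionalRegimeAtAdd_twisted_diagonal_two (hC : ChernCharacterOnBetti) {Adm : PerfectAdmissibility}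
    (hDiag : ∀ (C : ChernCharacterBetti) (m : ℕ), 2 ≤ m →
      LefAtExceptionalRegimeAtAdd (twistedReflexiveClass C Adm) (2 * m) m)
    (hDoor : ∀ C : ChernCharacterBetti, TwistedPerfectDoorVHC C Adm)
    (hR : raynaud1970_abelianScheme_section_projective) (h₂₁ : andre1996_cmAnchoredPencil)
    (h₂₂ : andre1996_cmHodgeClasses_algebraicallyAnchoredPencils) :
    Theses.PadicSemiregularLift.HodgeAbelianVarieties := by
  obtain ⟨C⟩ := hC
  exact hc_av_of_exceptionalRegimeAtAdd_diagonal_two (𝒪 := twistedReflexiveClass C Adm) (hDoor C) (hDiag C)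
    (oneParameterAbelianSchemeQuasiProjective_of_raynaud1970 hR) h₂₁ h₂₂

/-- **The same from `(6, 3)` on, granted `HCUpToDim 5`** (Markman 2025 Cor. 1.3, UNREFEREED), every `Adm`.
[cite: Andre1996Motifs, §6.3 Lemmes 6.3.1–6.3.3] [cite: Markman2025SurveySecant, Cor. 1.3]
[cite: BrosnanFangNiePearlstein2009, §6 Lemma 48] [cite: GortzWedhorn2023, Thm. 27.291] -/
theorem hc_av_of_hcUpToDim_five_of_exceptionalRegimeAtAdd_twisted_diagonal_three (hC : ChernCharacterOnBetti)
    {Adm : PerfectAdmissibility} (h₅ : HCUpToDim 5)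
    (hDiag : ∀ (C : ChernCharacterBetti) (m : ℕ), 3 ≤ m →
      LefAtExceptionalRegimeAtAdd (twistedReflexiveClass C Adm) (2 * m) m)
    (hDoor : ∀ C : ChernCharacterBetti, TwistedPerfectDoorVHC C Adm)
    (hR : raynaud1970_abelianScheme_section_projective) (h₂₁ : andre1996_cmAnchoredPencil)
    (h₂₂ : andre1996_cmHodgeClasses_algebraicallyAnchoredPencils) :
    Theses.PadicSemiregularLift.HodgeAbelianVarieties := by
  obtain ⟨C⟩ := hC
  exact hc_av_of_hcUpToDim_five_of_lefAtDegAdd_diagonal_three (𝒪 := twistedReflexiveClass C Adm) (hDoor C) h₅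
    (fun m hm => admissibleRepresentativesLefAtDegAdd_of_regimeAdd (hDiag C m hm))
    (oneParameterAbelianSchemeQuasiProjective_of_raynaud1970 hR) h₂₁ h₂₂

/-- **`HC_AV` in the `closes`-shape at the road's PRIMED twisted door `AdmTw' := gluableSigmaAdmissible ∨ bfSingleAdmissible'`, crux
= the ADDITIVE diagonal slice** — EXACTLY the binder shape of the glue of record `hc_av_of_exceptionalRegimeAt_admTw'_diagonal_two`
(`hC hDiag hDoor hR h₂₁ h₂₂`, `Theses.VHCAbelianSchemesRoad.closes`), with `hDiag` the additive slice and `hDoor` the body of item 20706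
`TwistedPerfectDoorPrime` VERBATIM. [cite: Andre1996Motifs, §6.3 Lemmes 6.3.1–6.3.3] [cite: BuchweitzFlenner2003, §5 Thm. 5.1]
[cite: Pridham2024Semiregularity, Rem. 2.26 with Cor. 2.25] [cite: Markman2025SecantWeil, Thm. 1.4.1 and Thm. 1.5.1] -/
theorem hc_av_of_exceptionalRegimeAtAdd_admTw'_diagonal_two (hC : ChernCharacterOnBetti)
    (hDiagAdd : ∀ (C : ChernCharacterBetti) (m : ℕ), 2 ≤ m →
      LefAtExceptionalRegimeAtAdd (twistedReflexiveClass C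
        (fun n X₀ I E => Summit.Ventures.HSemireg.gluableSigmaAdmissible n X₀ I E ∨ bfSingleAdmissible' n X₀ I E)) (2 * m) m)
    (hDoor : ∀ C : ChernCharacterBetti, TwistedPerfectDoorVHC C
      (fun n X₀ I E => Summit.Ventures.HSemireg.gluableSigmaAdmissible n X₀ I E ∨ bfSingleAdmissible' n X₀ I E))
    (hR : raynaud1970_abelianScheme_section_projective) (h₂₁ : andre1996_cmAnchoredPencil)
    (h₂₂ : andre1996_cmHodgeClasses_algebraicallyAnchoredPencils) :
    Theses.PadicSemiregularLift.HodgeAbelianVarieties :=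
  hc_av_of_exceptionalRegimeAtAdd_twisted_diagonal_two hC hDiagAdd hDoor hR h₂₁ h₂₂

/-- **The same at `AdmTw'` from `(6, 3)` on, granted `HCUpToDim 5`.** [cite: Andre1996Motifs, §6.3 Lemmes 6.3.1–6.3.3]
[cite: Markman2025SurveySecant, Cor. 1.3] [cite: Markman2025SecantWeil, Thm. 1.5.1] -/
theorem hc_av_of_hcUpToDim_five_of_exceptionalRegimeAtAdd_admTw'_diagonal_three (hC : ChernCharacterOnBetti)
    (h₅ : HCUpToDim 5)
    (hDiagAdd : ∀ (C : ChernCharacterBetti) (m : ℕ), 3 ≤ m →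
      LefAtExceptionalRegimeAtAdd (twistedReflexiveClass C
        (fun n X₀ I E => Summit.Ventures.HSemireg.gluableSigmaAdmissible n X₀ I E ∨ bfSingleAdmissible' n X₀ I E)) (2 * m) m)
    (hDoor : ∀ C : ChernCharacterBetti, TwistedPerfectDoorVHC C
      (fun n X₀ I E => Summit.Ventures.HSemireg.gluableSigmaAdmissible n X₀ I E ∨ bfSingleAdmissible' n X₀ I E))
    (hR : raynaud1970_abelianScheme_section_projective) (h₂₁ : andre1996_cmAnchoredPencil)
    (h₂₂ : andre1996_cmHodgeClasses_algebraicallyAnchoredPencils) :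
    Theses.PadicSemiregularLift.HodgeAbelianVarieties :=
  hc_av_of_hcUpToDim_five_of_exceptionalRegimeAtAdd_twisted_diagonal_three hC h₅ hDiagAdd hDoor hR h₂₁ h₂₂

/-- **The slice of record IMPLIES the additive slice** (single ⟹ additive, per `C` and `m`): item 20707's
`SemiregularSheafRepresentativesTwPrimeAtDiag` is the STRONGER parent of the additive diagonal slice at `AdmTw'`. [folklore] -/
theorem exceptionalRegimeAtAdd_admTw'_diagonal_of_exceptionalRegimeAt
    (hDiag : ∀ (C : ChernCharacterBetti) (m : ℕ), 2 ≤ m →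
      LefAtExceptionalRegimeAt (twistedReflexiveClass C
        (fun n X₀ I E => Summit.Ventures.HSemireg.gluableSigmaAdmissible n X₀ I E ∨ bfSingleAdmissible' n X₀ I E)) (2 * m) m) :
    ∀ (C : ChernCharacterBetti) (m : ℕ), 2 ≤ m →
      LefAtExceptionalRegimeAtAdd (twistedReflexiveClass C
        (fun n X₀ I E => Summit.Ventures.HSemireg.gluableSigmaAdmissible n X₀ I E ∨ bfSingleAdmissible' n X₀ I E)) (2 * m) m :=
  fun C m hm => lefAtExceptionalRegimeAtAdd_of_lefAtExceptionalRegimeAt (hDiag C m hm)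

end Summit.HodgeConjecture.HodgeConjecture.Ring2.SemiregularRepresentatives

end
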